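/-
Copyright (c) 2026. All rights reserved.
Released under Apache 2.0 license as described in the file LICENSE.
Authors: abc-iut cell, prover seat abc-iut-w5-d053 (gen 5; row «COR55iii-TS-OBSERVABLE», archimedean twin = abc-iut-L4-t5 gen 8's
wanted row F1), over abc-iut-L4-t3's statements, abc-iut-f-101's `⊞`-observable construction and abc-iut-L4-t5's archimedean
reduction (see the imports).
-/
import Literature.AnabelianGeometry.AbsoluteAnabelian.LogFrobeniusNotSimCompatArchAllTS
import Literature.AnabelianGeometry.AbsoluteAnabelian.LogFrobeniusObservablesOfIotaSquare
import Literature.AnabelianGeometry.AbsoluteAnabelian.LogFrobeniusArchGenuineObservables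
import Literature.AnabelianGeometry.AbsoluteAnabelian.StrictHomotopyFamilies
import HarnessLib

/-!
# [AbsTopIII] Cor 5.5 (iii), `TS`-half at ARCHIMEDEAN places: the observable `S_log` pushed forward from `S_log⊞`
# (FACT-LIST F-3080 `Cor55ObservablesTS` at the archimedean places of EVERY setting, and at `archGenuine 𝔄`)

S. Mochizuki, *Topics in absolute anabelian geometry III*, J. Math. Sci. Univ. Tokyo 22 (2015) [MochizukiAbsTopIII2015];
locators = pages of the kurims manuscript (`paper:url-5493eb38cbb7`): Def 5.4 (v) p. 127 («we shall refer … to Γ⃗^log_v itself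
as Γ⃗^⋉_v» at an archimedean `v`), Def 5.4 (vii) p. 128 (`ι_{v,ε}` = `ι⊞_{v,ε}` composed with `𝒩⊞_v → 𝒩_v` on `Γ⃗^⋉_v`), Cor 5.5 (iii)
p. 131 l. 29–62 («the natural transformations ι⊞_{v,ε} (respectively, ι_{v,ε}) … belong to a family of homotopies on D•≤3
(respectively, D•≤4) that determines … a structure of observable S_log⊞ (respectively, S_log)»), proof p. 132 l. 40–63.

## What this file proves (PROOF + one auxiliary structure; no Prop fact)

The `TS`-valued observable `S_log_v` of Cor 5.5 (iii) — abc-iut-L4-t3's `IsLogObservableTS` / `Cor55ObservablesTS` (F-3080),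
an ASSUMPTION on `(L, T)` whose universal closure is refuted at degenerate settings (abc-iut-w5-d097) and which was, before
this file, witnessed in the tree only at the degenerate diagonal setting — EXISTS at every ARCHIMEDEAN place of EVERY setting
`L` for EVERY `TS`-datum `T`, by PUSHING FORWARD an `S_log⊞_v`-family along the edge `𝒩⊞_v → 𝒩_v`:

* `pushFamily H` — for a family `H` on the `⊞`-diagram `D•≤2 ∪ {𝒩⊞_v}` all of whose boundary pairs end at `𝒩⊞_v`, the family on
  the `TS`-diagram `(D•≤2 ∪ {𝒩⊞_v}) ∪ {𝒩_v}` whose boundary pairs are the pairs `(γ₁·[𝒩⊞_v→𝒩_v], γ₂·[𝒩⊞_v→𝒩_v])` for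
  `(γ₁, γ₂)` a boundary pair of `H` with source in `D•≤2`, with homotopy `ζ ▷ (𝒩⊞_v → 𝒩_v)` (Def 3.5 (ii): saturation and the
  three laws are inherited — §0 (a)(c)(d)(e));
* `isLogObservableTS_pushFamily` — at an ARCHIMEDEAN `v`, if `H` is an `S_log⊞_v` (`IsLogObservablePlus`) then `pushFamily H` is
  an `S_log_v` (`IsLogObservableTS T`): there `Γ⃗^log_v = Γ⃗^⋉_v` and `ι_{v,ε} = ι⊞_{v,ε} ▷ (𝒩⊞_v → 𝒩_v)` (abc-iut-L4-t5's
  `TSHomotopies.exists_iota_eq_whiskerRight`);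
* `exists_isLogObservableTS_of_isArc` — hence an `S_log_v` exists at EVERY archimedean place of every `(L, T)` (the `⊞` side being
  automatic there: abc-iut-f-101's `iotaSquaresCommute_of_isArc` + `exists_isLogObservablePlus_iff`);
* `cor55ObservablesTS_of_forall_isArc`, `archGenuine_cor55ObservablesTS` — F-3080 HOLDS for every setting over an all-archimedean
  index set, in particular at abc-iut-w4-d095's `archGenuine 𝔄` (honest NON-VACUITY of the `S_log` constituent inside the `¬∃` of
  Cor 5.5 (iv) at the archimedean carriers — the INFO item of the Cor5.5(iv) count-read, 2026-08-27).

NOT covered (honest scope): NONARCHIMEDEAN places — there `Γ⃗^log_v ⊋ Γ⃗^⋉_v` (the `TS`-only edge `k̄^× ↪ k̄`), so the pushed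
family misses one printed generator; the generic nonarchimedean construction (the `TS` analogue of abc-iut-f-101's
`LogFrobeniusObservablesMoves` + `…OfIotaSquare`) is specified in HOME/…/WANTED-TS-OBSERVABLE-GENERIC.md for a later seat.

HONEST FRAMING: interface-level category theory over abc-iut-L4-t3's typed statements; refereed pre-IUT material; nothing here
bears on [IUTchIII] Cor. 3.12; no side taken; typed ≠ proved elsewhere.
-/

set_option autoImplicit false

universe u

open CategoryTheory Quiver

namespace Literature.AnabelianGeometry.AbsoluteAnabelian

namespace LogFrobeniusSetting

variable {Vmod : Type u} {isArc : Vmod → Bool} (L : LogFrobeniusSetting Vmod isArc) (v : Vmod)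

/-! ## §1. The `⊞`-shape inside the `TS`-shape -/

/-- The vertices of the `⊞`-shape `D•≤2 ∪ {𝒩⊞_v}` seen in the `TS`-shape `(D•≤2 ∪ {𝒩⊞_v}) ∪ {𝒩_v}` (the old observation vertex
`𝒩⊞_v` becomes an ordinary vertex). [cite: MochizukiAbsTopIII2015, Cor 5.5 (iii) p. 131] -/
@[reducible] def plusToTSObj : (logShapePlus (isArc := isArc) v).Vertex → (logShapeTS (isArc := isArc) v).Vertex
  | ExtVertex.base x => (logShapeTS v).base ⟨x.1, Or.inl x.2⟩
  | ExtVertex.obs => (logShapeTS v).base ⟨.nplus v, nplus_mem_portion v⟩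

/-- … and its edges (the same arrows of `D•`). [cite: MochizukiAbsTopIII2015, Cor 5.5 (iii) p. 131] -/
@[reducible] def plusToTSMap : ∀ {a b : (logShapePlus (isArc := isArc) v).Vertex},
    (a ⟶ b) → (plusToTSObj (isArc := isArc) v a ⟶ plusToTSObj (isArc := isArc) v b)
  | ExtVertex.base _, ExtVertex.base _, e => e
  | ExtVertex.base _, ExtVertex.obs, e => e
  | ExtVertex.obs, ExtVertex.base _, j => PEmpty.elim j
  | ExtVertex.obs, ExtVertex.obs, e => PEmpty.elim e

/-- The inclusion of oriented graphs `Γ⃗(S_log⊞_v) ↪ Γ⃗(S_log_v)`. [cite: MochizukiAbsTopIII2015, Cor 5.5 (iii) p. 131] -/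
@[reducible] def plusToTS : (logShapePlus (isArc := isArc) v).Vertex ⥤q (logShapeTS (isArc := isArc) v).Vertex where
  obj := plusToTSObj v
  map := plusToTSMap v

/-- A path of the `TS`-shape starting at the new observation vertex `𝒩_v` is trivial (no edge leaves `𝒩_v`).
[cite: MochizukiAbsTopIII2015, Definition 3.5 (iii) p.75] -/
theorem eq_obs_of_path_from_obs :
    ∀ {c : (logShapeTS (isArc := isArc) v).Vertex}, Path (logShapeTS (isArc := isArc) v).obs c →
      c = (logShapeTS (isArc := isArc) v).obs := by
  intro c r
  induction r with
  | nil => rfl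
  | cons r e ih =>
    rename_i b c
    subst ih
    cases c with
    | base _ => exact (PEmpty.elim e)
    | obs => exact (PEmpty.elim e)

/-- Hence such a path is `nil`. [cite: MochizukiAbsTopIII2015, Definition 3.5 (iii) p.75] -/
theorem path_from_obs_heq_nil {c : (logShapeTS (isArc := isArc) v).Vertex}
    (r : Path (logShapeTS (isArc := isArc) v).obs c) : HEq r (Path.nil : Path (logShapeTS (isArc := isArc) v).obs _) := by
  have hc := eq_obs_of_path_from_obs v r
  subst hc
  cases r with
  | nil => rfl
  | cons r e =>
    rename_i b
    have hb := eq_obs_of_path_from_obs v r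
    subst hb
    exact (PEmpty.elim e)

/-- Every path of the `TS`-shape INTO a vertex of `D•≤2` comes from the `⊞`-shape (no arrow of the portion leaves `𝒩⊞_v` except
towards `𝒩_v`). [cite: MochizukiAbsTopIII2015, Cor 5.5 (iii) p. 131] -/
theorem exists_eq_mapPath {c t : (logShapeTS (isArc := isArc) v).Vertex} (r : Path c t) :
    ∀ (x : DSub (DVertex.InFirstRows (isArc := isArc) 2)), t = (logShapeTS v).base ⟨x.1, Or.inl x.2⟩ →
      ∃ (y : DSub (DVertex.InFirstRows (isArc := isArc) 2)) (_ : c = (logShapeTS v).base ⟨y.1, Or.inl y.2⟩)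
        (r₀ : Path ((logShapePlus (isArc := isArc) v).base y) ((logShapePlus v).base x)),
        HEq r ((plusToTS v).mapPath r₀) := by
  induction r with
  | nil => intro x ht; exact ⟨x, ht, Path.nil, by subst ht; rfl⟩
  | cons r e ih =>
    rename_i d t
    intro x ht
    subst ht
    obtain ⟨xv, hx⟩ := x
    cases d with
    | obs => exact (PEmpty.elim e)
    | base z =>
      obtain ⟨zv, hz⟩ := z
      -- `e : DEdge zv xv` with `xv` in the first two rows: only `log` and `id_⋎` qualify
      change DEdge isArc zv xv at e
      cases e with
      | log n =>
        obtain ⟨y, hc, r₀, hr⟩ := ih ⟨.row1 (n + 1), row1_mem_two (n + 1)⟩ rfl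
        refine ⟨y, hc, r₀.cons (show (logShapePlus (isArc := isArc) v).base ⟨.row1 (n + 1), row1_mem_two (n + 1)⟩ ⟶
          (logShapePlus v).base ⟨.row1 n, hx⟩ from DEdge.log n), ?_⟩
        subst hc
        cases eq_of_heq hr
        rfl
      | toCore n =>
        obtain ⟨y, hc, r₀, hr⟩ := ih ⟨.row1 n, row1_mem_two n⟩ rfl
        refine ⟨y, hc, r₀.cons (show (logShapePlus (isArc := isArc) v).base ⟨.row1 n, row1_mem_two n⟩ ⟶
          (logShapePlus v).base ⟨.core, hx⟩ from DEdge.toCore n), ?_⟩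
        subst hc
        cases eq_of_heq hr
        rfl
      | lam w ν hν => exact absurd hx.2 (by simp [DVertex.row])
      | forget w => exact absurd hx.2 (by simp [DVertex.row])
      | toE w => exact absurd hx.2 (by simp [DVertex.row])
      | κAn => exact absurd hx.2 (by simp [DVertex.row])
      | anToE => exact absurd hx.2 (by simp [DVertex.row])
      | monoNplus w => exact absurd hx.1 (by simp [DVertex.IsHolomorphic])
      | monoN w => exact absurd hx.1 (by simp [DVertex.IsHolomorphic])
      | monoE5 => exact absurd hx.1 (by simp [DVertex.IsHolomorphic])
      | monoAn => exact absurd hx.1 (by simp [DVertex.IsHolomorphic])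
      | monoE7 => exact absurd hx.1 (by simp [DVertex.IsHolomorphic])
      | forgetMono w => exact absurd hx.1 (by simp [DVertex.IsHolomorphic])
      | toEmono w => exact absurd hx.1 (by simp [DVertex.IsHolomorphic])
      | κAnMono => exact absurd hx.1 (by simp [DVertex.IsHolomorphic])
      | anMonoToE => exact absurd hx.1 (by simp [DVertex.IsHolomorphic])

/-- `plusToTS` is injective on objects. [cite: MochizukiAbsTopIII2015, Cor 5.5 (iii) p. 131] -/
theorem plusToTS_obj_injective : Function.Injective (plusToTS (isArc := isArc) v).obj := by
  intro a b h
  cases a with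
  | base x =>
    cases b with
    | base y =>
      change ExtVertex.base _ = ExtVertex.base _ at h
      have h0 := ExtVertex.base.inj h
      have h1 : x.1 = y.1 := Subtype.mk.inj h0
      rw [Subtype.ext h1]
    | obs =>
      change ExtVertex.base _ = ExtVertex.base _ at h
      have h0 := ExtVertex.base.inj h
      have h1 : x.1 = .nplus v := Subtype.mk.inj h0
      exact absurd x.2.2 (by rw [h1]; simp [DVertex.row])
  | obs =>
    cases b with
    | base y =>
      change ExtVertex.base _ = ExtVertex.base _ at h
      have h0 := ExtVertex.base.inj h
      have h1 : DVertex.nplus v = y.1 := Subtype.mk.inj h0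
      exact absurd y.2.2 (by rw [← h1]; simp [DVertex.row])
    | obs => rfl

/-- `plusToTS` is injective on arrows. [cite: MochizukiAbsTopIII2015, Cor 5.5 (iii) p. 131] -/
theorem plusToTS_map_injective {a b : (logShapePlus (isArc := isArc) v).Vertex} :
    Function.Injective ((plusToTS (isArc := isArc) v).map : (a ⟶ b) → _) := by
  intro e e' h
  cases a with
  | base x =>
    cases b with
    | base y => exact h
    | obs => exact h
  | obs => exact (PEmpty.elim (show PEmpty from by cases b <;> exact e))

/-- `plusToTS` is injective on paths. [cite: MochizukiAbsTopIII2015, Cor 5.5 (iii) p. 131] -/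
theorem plusToTS_mapPath_injective {a : (logShapePlus (isArc := isArc) v).Vertex} :
    ∀ {b : (logShapePlus (isArc := isArc) v).Vertex} (p q : Path a b),
      (plusToTS (isArc := isArc) v).mapPath p = (plusToTS v).mapPath q → p = q
  | _, Path.nil, q, h => by
    cases q with
    | nil => rfl
    | cons q e =>
      have hl := congrArg Path.length h
      simp [Prefunctor.mapPath_cons, Path.length_cons] at hl
  | _, Path.cons p e, q, h => by
    cases q with
    | nil =>
      have hl := congrArg Path.length h
      simp [Prefunctor.mapPath_cons, Path.length_cons] at hl
    | cons q e' =>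
      rename_i c c'
      rw [Prefunctor.mapPath_cons, Prefunctor.mapPath_cons] at h
      obtain ⟨hcc, hpq, hee⟩ := Path.cons.inj h
      cases plusToTS_obj_injective v hcc
      cases plusToTS_map_injective v (eq_of_heq hee)
      rw [plusToTS_mapPath_injective p q (eq_of_heq hpq)]

/-! ## §2. Path functors agree along the inclusion -/

/-- The path functor of the `TS`-diagram along an included path IS the path functor of the `⊞`-diagram (structural variants;
`HEq` across the definitionally-matching vertex categories). [cite: MochizukiAbsTopIII2015, Definition 3.5 (i) pp.74–75] -/
theorem pathFunctor'_plusToTS_heq (x : DSub (DVertex.InFirstRows (isArc := isArc) 2)) :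
    ∀ {b : (logShapePlus (isArc := isArc) v).Vertex} (p : Path ((logShapePlus (isArc := isArc) v).base x) b),
      HEq ((L.logDiagramTS v).pathFunctor' ((plusToTS v).mapPath p)) ((L.logDiagramPlus v).pathFunctor' p)
  | _, Path.nil => HEq.rfl
  | _, Path.cons (b := b) (c := c) p e => by
    have ih := pathFunctor'_plusToTS_heq x p
    rw [Prefunctor.mapPath_cons, DiagramOfCategories.pathFunctor'_cons, DiagramOfCategories.pathFunctor'_cons]
    cases b with
    | obs => cases c <;> exact (PEmpty.elim e)
    | base y =>
      cases c with
      | base z => rw [eq_of_heq ih]; rfl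
      | obs => rw [eq_of_heq ih]; rfl

/-- In particular, for paths into `𝒩⊞_v` (same vertex categories on both sides): an honest equation, continued to the
non-structural path functor of the `⊞`-diagram. [cite: MochizukiAbsTopIII2015, Definition 3.5 (i) pp.74–75] -/
theorem pathFunctor'_plusToTS_eq (x : DSub (DVertex.InFirstRows (isArc := isArc) 2))
    (p : Path ((logShapePlus (isArc := isArc) v).base x) (logShapePlus (isArc := isArc) v).obs) :
    (L.logDiagramTS v).pathFunctor' ((plusToTS v).mapPath p) = (L.logDiagramPlus v).pathFunctor p :=
  (eq_of_heq (L.pathFunctor'_plusToTS_heq v x p)).trans ((L.logDiagramPlus v).pathFunctor_eq_pathFunctor' p).symm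

/-- Conjugating by `eqToHom`s along definitional identifications does nothing (`HEq` form).
[cite: MochizukiAbsTopIII2015, Definition 3.5 (ii) p.75] -/
theorem eqToHom_conj_eq_of_heq {C : Type*} [Category C] {X Y X' Y' : C} (hX : X' = X) (f : X ⟶ Y) (hY : Y = Y')
    (g : X' ⟶ Y') (hg : HEq f g) : eqToHom hX ≫ f ≫ eqToHom hY = g := by
  subst hX hY
  simp [eq_of_heq hg]

/-! ## §3. The pushed-forward family -/

/-- Presentation data of a boundary pair of the pushed family: a boundary pair `(p, q)` of `H` with source in `D•≤2` whose images
followed by `[𝒩⊞_v → 𝒩_v]` are the given `TS`-paths. [cite: MochizukiAbsTopIII2015, Definition 3.5 (ii) p.75] -/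
structure PushPair (H : (L.logDiagramPlus v).HomotopyFamily) {a' b' : (logShapeTS (isArc := isArc) v).Vertex}
    (p' q' : Path a' b') : Type u where
  /-- the source vertex in `D•≤2` -/
  x : DSub (DVertex.InFirstRows (isArc := isArc) 2)
  /-- the first path of the `⊞`-pair -/
  p : Path ((logShapePlus (isArc := isArc) v).base x) (logShapePlus (isArc := isArc) v).obs
  /-- the second path of the `⊞`-pair -/
  q : Path ((logShapePlus (isArc := isArc) v).base x) (logShapePlus (isArc := isArc) v).obs
  mem : H.E p q
  src : a' = (logShapeTS v).base ⟨x.1, Or.inl x.2⟩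
  tgt : b' = (logShapeTS v).obs
  left : HEq p' (((plusToTS v).mapPath p).cons (forgetEdgeTS (isArc := isArc) v))
  right : HEq q' (((plusToTS v).mapPath q).cons (forgetEdgeTS (isArc := isArc) v))

variable {L v}

namespace PushPair

variable {H : (L.logDiagramPlus v).HomotopyFamily}

/-- Two presentations of the same `TS`-pair have the same source and the same `⊞`-paths.
[cite: MochizukiAbsTopIII2015, Definition 3.5 (ii) p.75] -/
theorem unique {a' b' : (logShapeTS (isArc := isArc) v).Vertex} {p' q' : Path a' b'} (w₁ w₂ : PushPair L v H p' q') :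
    w₁.x = w₂.x ∧ HEq w₁.p w₂.p ∧ HEq w₁.q w₂.q := by
  obtain ⟨x₁, p₁, q₁, m₁, s₁, t₁, l₁, r₁⟩ := w₁
  obtain ⟨x₂, p₂, q₂, m₂, s₂, t₂, l₂, r₂⟩ := w₂
  subst s₁ t₁
  change ExtVertex.base _ = ExtVertex.base _ at s₂
  have h0 := ExtVertex.base.inj s₂
  have hx : x₁ = x₂ := Subtype.ext (Subtype.mk.inj h0)
  subst hx
  have hp := eq_of_heq (l₁.symm.trans l₂)
  have hq := eq_of_heq (r₁.symm.trans r₂)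
  obtain ⟨-, hp, -⟩ := Path.cons.inj hp
  obtain ⟨-, hq, -⟩ := Path.cons.inj hq
  exact ⟨rfl, heq_of_eq (plusToTS_mapPath_injective v _ _ (eq_of_heq hp)),
    heq_of_eq (plusToTS_mapPath_injective v _ _ (eq_of_heq hq))⟩

/-- The canonical presentation of a pushed pair. [cite: MochizukiAbsTopIII2015, Definition 3.5 (ii) p.75] -/
def ofMem (x : DSub (DVertex.InFirstRows (isArc := isArc) 2))
    {p q : Path ((logShapePlus (isArc := isArc) v).base x) (logShapePlus (isArc := isArc) v).obs} (h : H.E p q) :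
    PushPair L v H (((plusToTS v).mapPath p).cons (forgetEdgeTS (isArc := isArc) v))
      (((plusToTS v).mapPath q).cons (forgetEdgeTS (isArc := isArc) v)) :=
  ⟨x, p, q, h, rfl, rfl, HEq.rfl, HEq.rfl⟩

end PushPair

/-- The boundary set of the pushed family: `Nonempty (PushPair …)`. [cite: MochizukiAbsTopIII2015, Definition 3.5 (ii) p.75] -/
def PushE (H : (L.logDiagramPlus v).HomotopyFamily) ⦃a' b' : (logShapeTS (isArc := isArc) v).Vertex⦄ (p' q' : Path a' b') : Prop :=
  Nonempty (PushPair L v H p' q')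

/-- The boundary set of the pushed family is saturated (§0 (a)(c)(d)(e)): partial reflexivity and transitivity from `H`;
pre-composition — every path into a vertex of `D•≤2` comes from the `⊞`-shape; post-composition — no path leaves `𝒩_v`.
[cite: MochizukiAbsTopIII2015, Section 0 p.26] -/
theorem isSaturated_pushE (H : (L.logDiagramPlus v).HomotopyFamily) : IsSaturated (PushE (L := L) (v := v) H) where
  refl_left := by
    rintro a' b' p' q' ⟨⟨x, p, q, m, s, t, l, r⟩⟩
    exact ⟨⟨x, p, p, H.isSaturated.refl_left m, s, t, l, l⟩⟩
  refl_right := by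
    rintro a' b' p' q' ⟨⟨x, p, q, m, s, t, l, r⟩⟩
    exact ⟨⟨x, q, q, H.isSaturated.refl_right m, s, t, r, r⟩⟩
  trans := by
    rintro a' b' p' q' r' ⟨w₁⟩ ⟨w₂⟩
    have hu := PushPair.unique (⟨w₁.x, w₁.q, w₁.q, H.isSaturated.refl_right w₁.mem, w₁.src, w₁.tgt, w₁.right, w₁.right⟩ :
      PushPair L v H q' q') ⟨w₂.x, w₂.p, w₂.p, H.isSaturated.refl_left w₂.mem, w₂.src, w₂.tgt, w₂.left, w₂.left⟩
    obtain ⟨x₁, p₁, q₁, m₁, s₁, t₁, l₁, r₁⟩ := w₁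
    obtain ⟨x₂, p₂, q₂, m₂, s₂, t₂, l₂, r₂⟩ := w₂
    obtain ⟨hx, hq, -⟩ := hu
    dsimp only at hx hq
    subst hx
    cases eq_of_heq hq
    exact ⟨⟨x₁, p₁, q₂, H.isSaturated.trans m₁ m₂, s₁, t₁, l₁, r₂⟩⟩
  precomp := by
    rintro a' b' c' p' q' ⟨⟨x, p, q, m, s, t, l, r⟩⟩ r'
    subst s t
    cases eq_of_heq l
    cases eq_of_heq r
    obtain ⟨y, hc, r₀, hr⟩ := exists_eq_mapPath v r' x rfl
    subst hc
    cases eq_of_heq hr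
    refine ⟨⟨y, r₀.comp p, r₀.comp q, H.isSaturated.precomp m r₀, rfl, rfl, ?_, ?_⟩⟩
    · rw [Prefunctor.mapPath_comp]; rfl
    · rw [Prefunctor.mapPath_comp]; rfl
  postcomp := by
    rintro a' b' c' p' q' ⟨⟨x, p, q, m, s, t, l, r⟩⟩ r₂
    subst s t
    have hc := eq_obs_of_path_from_obs v r₂
    subst hc
    cases eq_of_heq (path_from_obs_heq_nil v r₂)
    exact ⟨⟨x, p, q, m, rfl, rfl, l, r⟩⟩

/-! ### The homotopies: `ζ ▷ (𝒩⊞_v → 𝒩_v)` -/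

/-- The homotopy of `H` at a `⊞`-pair, read between the STRUCTURAL path functors of the `TS`-diagram along the included paths.
[cite: MochizukiAbsTopIII2015, Definition 3.5 (ii) p.75] -/
noncomputable def plusη (H : (L.logDiagramPlus v).HomotopyFamily) (x : DSub (DVertex.InFirstRows (isArc := isArc) 2))
    {p q : Path ((logShapePlus (isArc := isArc) v).base x) (logShapePlus (isArc := isArc) v).obs} (h : H.E p q) :
    (L.logDiagramTS v).pathFunctor' ((plusToTS v).mapPath p) ⟶ (L.logDiagramTS v).pathFunctor' ((plusToTS v).mapPath q) :=
  eqToHom (L.pathFunctor'_plusToTS_eq v x p) ≫ H.η h ≫ eqToHom (L.pathFunctor'_plusToTS_eq v x q).symm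

/-- The pushed homotopy `ζ ▷ (𝒩⊞_v → 𝒩_v)` at a presented pair (between structural path functors; the last edge functor IS
`𝒩⊞_v → 𝒩_v`). [cite: MochizukiAbsTopIII2015, Definition 3.5 (ii) p.75] -/
noncomputable def pushηOfPair (H : (L.logDiagramPlus v).HomotopyFamily) {a' b' : (logShapeTS (isArc := isArc) v).Vertex}
    {p' q' : Path a' b'} (w : PushPair L v H p' q') :
    (L.logDiagramTS v).pathFunctor' p' ⟶ (L.logDiagramTS v).pathFunctor' q' :=
  match a', b', p', q', w with
  | _, _, _, _, ⟨x, p, q, m, rfl, rfl, l, r⟩ =>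
    eqToHom (by rw [eq_of_heq l]; rfl) ≫ Functor.whiskerRight (plusη H x m) (L.forget v) ≫ eqToHom (by rw [eq_of_heq r]; rfl)

/-- On the canonical presentation the pushed homotopy is literally `ζ ▷ (𝒩⊞_v → 𝒩_v)`.
[cite: MochizukiAbsTopIII2015, Definition 3.5 (ii) p.75] -/
theorem pushηOfPair_ofMem (H : (L.logDiagramPlus v).HomotopyFamily) (x : DSub (DVertex.InFirstRows (isArc := isArc) 2))
    {p q : Path ((logShapePlus (isArc := isArc) v).base x) (logShapePlus (isArc := isArc) v).obs} (h : H.E p q) :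
    pushηOfPair H (PushPair.ofMem (L := L) (v := v) x h) = Functor.whiskerRight (plusη H x h) (L.forget v) := by
  unfold pushηOfPair PushPair.ofMem
  exact eqToHom_conj_eq_of_heq _ _ _ _ HEq.rfl

/-- The pushed homotopy does not depend on the presentation. [cite: MochizukiAbsTopIII2015, Definition 3.5 (ii) p.75] -/
theorem pushηOfPair_eq (H : (L.logDiagramPlus v).HomotopyFamily) {a' b' : (logShapeTS (isArc := isArc) v).Vertex}
    {p' q' : Path a' b'} (w₁ w₂ : PushPair L v H p' q') : pushηOfPair H w₁ = pushηOfPair H w₂ := by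
  have hu := PushPair.unique w₁ w₂
  obtain ⟨x₁, p₁, q₁, m₁, s₁, t₁, l₁, r₁⟩ := w₁
  obtain ⟨x₂, p₂, q₂, m₂, s₂, t₂, l₂, r₂⟩ := w₂
  obtain ⟨hx, hp, hq⟩ := hu
  dsimp only at hx hp hq
  subst hx
  cases eq_of_heq hp
  cases eq_of_heq hq
  subst s₁ t₁
  cases eq_of_heq l₁
  cases eq_of_heq r₁
  rfl

/-- The homotopy of the pushed family at a boundary pair (any presentation). [cite: MochizukiAbsTopIII2015, Definition 3.5 (ii) p.75] -/
noncomputable def pushη (H : (L.logDiagramPlus v).HomotopyFamily) ⦃a' b' : (logShapeTS (isArc := isArc) v).Vertex⦄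
    ⦃p' q' : Path a' b'⦄ (h : PushE (L := L) (v := v) H p' q') :
    (L.logDiagramTS v).pathFunctor' p' ⟶ (L.logDiagramTS v).pathFunctor' q' :=
  pushηOfPair H (Classical.choice h)

/-- `pushη` computed on any presentation. [cite: MochizukiAbsTopIII2015, Definition 3.5 (ii) p.75] -/
theorem pushη_eq (H : (L.logDiagramPlus v).HomotopyFamily) {a' b' : (logShapeTS (isArc := isArc) v).Vertex}
    {p' q' : Path a' b'} (w : PushPair L v H p' q') : pushη H ⟨w⟩ = pushηOfPair H w :=
  pushηOfPair_eq H _ _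

/-- `pushη` on a canonical pair: `ζ ▷ (𝒩⊞_v → 𝒩_v)`. [cite: MochizukiAbsTopIII2015, Definition 3.5 (ii) p.75] -/
theorem pushη_ofMem (H : (L.logDiagramPlus v).HomotopyFamily) (x : DSub (DVertex.InFirstRows (isArc := isArc) 2))
    {p q : Path ((logShapePlus (isArc := isArc) v).base x) (logShapePlus (isArc := isArc) v).obs} (h : H.E p q)
    (h' : PushE (L := L) (v := v) H (((plusToTS v).mapPath p).cons (forgetEdgeTS v)) (((plusToTS v).mapPath q).cons (forgetEdgeTS v))) :
    pushη H h' = Functor.whiskerRight (plusη H x h) (L.forget v) := by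
  rw [show h' = ⟨PushPair.ofMem x h⟩ from rfl, pushη_eq, pushηOfPair_ofMem]


/-! ### §4. The laws of Def 3.5 (ii) for the pushed homotopies, and the family -/

/-- Conjugation by `eqToHom`s is `HEq`-invisible. [cite: MochizukiAbsTopIII2015, Definition 3.5 (ii) p.75] -/
theorem heq_of_eqToHom_conj {C : Type*} [Category C] {W X Y Z : C} (h : W = X) (f : X ⟶ Y) (h' : Y = Z) :
    HEq (eqToHom h ≫ f ≫ eqToHom h') f := by
  subst h h'; simp

/-- Left-whiskering along equal functors, as an `HEq`. [cite: MochizukiAbsTopIII2015, Definition 3.5 (ii) p.75] -/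
theorem whiskerLeft_heq_of_eq {A B C : Type*} [Category A] [Category B] [Category C] {R R' : A ⥤ B} (hR : R = R')
    {F G F' G' : B ⥤ C} (hF : F = F') (hG : G = G') {α : F ⟶ G} {α' : F' ⟶ G'} (h : HEq α α') :
    HEq (Functor.whiskerLeft R α) (Functor.whiskerLeft R' α') := by
  subst hR hF hG; cases eq_of_heq h; rfl

/-- Right-whiskering `HEq`-equal natural transformations. [cite: MochizukiAbsTopIII2015, Definition 3.5 (ii) p.75] -/
theorem whiskerRight_heq_of_heq {A B C : Type*} [Category A] [Category B] [Category C] {F G F' G' : A ⥤ B}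
    (hF : F = F') (hG : G = G') {α : F ⟶ G} {α' : F' ⟶ G'} (h : HEq α α') (K : B ⥤ C) :
    HEq (Functor.whiskerRight α K) (Functor.whiskerRight α' K) := by
  subst hF hG; cases eq_of_heq h; rfl

/-- Components of `eqToHom`-conjugates. [cite: MochizukiAbsTopIII2015, Definition 3.5 (ii) p.75] -/
theorem app_eqToHom_conj_heq {A B : Type*} [Category A] [Category B] {F F' G G' : A ⥤ B} (e₁ : F' = F) (α : F ⟶ G)
    (e₂ : G = G') (X : A) : HEq ((eqToHom e₁ ≫ α ≫ eqToHom e₂).app X) (α.app X) := by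
  subst e₁ e₂; simp

/-- Functors respect `HEq` of morphisms between equal objects. [cite: MochizukiAbsTopIII2015, Definition 3.5 (ii) p.75] -/
theorem map_heq_of_heq {A B : Type*} [Category A] [Category B] (K : A ⥤ B) {a b a' b' : A} (ha : a = a') (hb : b = b')
    {f : a ⟶ b} {g : a' ⟶ b'} (h : HEq f g) : HEq (K.map f) (K.map g) := by
  subst ha hb; cases eq_of_heq h; rfl

/-- `plusη` is `HEq` to the homotopy of `H`. [cite: MochizukiAbsTopIII2015, Definition 3.5 (ii) p.75] -/
theorem plusη_heq (H : (L.logDiagramPlus v).HomotopyFamily) (x : DSub (DVertex.InFirstRows (isArc := isArc) 2))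
    {p q : Path ((logShapePlus (isArc := isArc) v).base x) (logShapePlus (isArc := isArc) v).obs} (h : H.E p q) :
    HEq (plusη H x h) (H.η h) :=
  heq_of_eqToHom_conj _ _ _

/-- `plusη` on a reflexive pair is the identity. [cite: MochizukiAbsTopIII2015, Definition 3.5 (ii) p.75] -/
theorem plusη_refl (H : (L.logDiagramPlus v).HomotopyFamily) (x : DSub (DVertex.InFirstRows (isArc := isArc) 2))
    {p : Path ((logShapePlus (isArc := isArc) v).base x) (logShapePlus (isArc := isArc) v).obs} (h : H.E p p) :
    plusη H x h = 𝟙 _ := by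
  apply eq_of_heq
  refine (plusη_heq H x h).trans ?_
  rw [H.η_refl h, L.pathFunctor'_plusToTS_eq v x p]
  exact HEq.rfl

/-- `plusη` is multiplicative. [cite: MochizukiAbsTopIII2015, Definition 3.5 (ii) p.75] -/
theorem plusη_trans (H : (L.logDiagramPlus v).HomotopyFamily) (x : DSub (DVertex.InFirstRows (isArc := isArc) 2))
    {p q r : Path ((logShapePlus (isArc := isArc) v).base x) (logShapePlus (isArc := isArc) v).obs} (h₁ : H.E p q)
    (h₂ : H.E q r) : plusη H x (H.isSaturated.trans h₁ h₂) = plusη H x h₁ ≫ plusη H x h₂ := by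
  apply eq_of_heq
  refine (plusη_heq H x _).trans ?_
  rw [H.η_trans h₁ h₂]
  -- `ζ₁ ≫ ζ₂ ≍ (e ≫ ζ₁ ≫ e⁻¹) ≫ (e ≫ ζ₂ ≫ e⁻¹)`
  have key : plusη H x h₁ ≫ plusη H x h₂ =
      eqToHom (L.pathFunctor'_plusToTS_eq v x p) ≫ (H.η h₁ ≫ H.η h₂) ≫ eqToHom (L.pathFunctor'_plusToTS_eq v x r).symm := by
    unfold plusη
    simp only [Category.assoc, eqToHom_trans_assoc, eqToHom_refl, Category.id_comp]
  exact ((heq_of_eq key).trans (heq_of_eqToHom_conj _ _ _)).symm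

/-- `pushη` on a reflexive pair is the identity. [cite: MochizukiAbsTopIII2015, Definition 3.5 (ii) p.75] -/
theorem pushη_refl (H : (L.logDiagramPlus v).HomotopyFamily) ⦃a' b' : (logShapeTS (isArc := isArc) v).Vertex⦄
    ⦃p' : Path a' b'⦄ (h : PushE (L := L) (v := v) H p' p') : pushη H h = 𝟙 _ := by
  obtain ⟨x, p, q, m, s, t, l, r⟩ := Classical.choice h
  subst s t
  cases eq_of_heq l
  obtain ⟨-, hpq, -⟩ := Path.cons.inj (eq_of_heq r)
  cases plusToTS_mapPath_injective v _ _ (eq_of_heq hpq)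
  refine (pushη_ofMem H x m h).trans ?_
  rw [plusη_refl H x m, Functor.whiskerRight_id']
  rfl

/-- `pushη` is multiplicative. [cite: MochizukiAbsTopIII2015, Definition 3.5 (ii) p.75] -/
theorem pushη_trans (H : (L.logDiagramPlus v).HomotopyFamily) ⦃a' b' : (logShapeTS (isArc := isArc) v).Vertex⦄
    ⦃p' q' r' : Path a' b'⦄ (h₁ : PushE (L := L) (v := v) H p' q') (h₂ : PushE (L := L) (v := v) H q' r') :
    pushη H ((isSaturated_pushE H).trans h₁ h₂) = pushη H h₁ ≫ pushη H h₂ := by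
  obtain ⟨x, p, q, m₁, s, t, l, r⟩ := Classical.choice h₁
  subst s t
  cases eq_of_heq l
  cases eq_of_heq r
  have w₂ := Classical.choice h₂
  have hu := PushPair.unique (⟨x, q, q, H.isSaturated.refl_right m₁, rfl, rfl, HEq.rfl, HEq.rfl⟩ :
    PushPair L v H _ _) ⟨w₂.x, w₂.p, w₂.p, H.isSaturated.refl_left w₂.mem, w₂.src, w₂.tgt, w₂.left, w₂.left⟩
  obtain ⟨x₂, p₂, q₂, m₂, s₂, t₂, l₂, r₂⟩ := w₂
  obtain ⟨hx, hq, -⟩ := hu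
  dsimp only at hx hq
  subst hx
  cases eq_of_heq hq
  cases eq_of_heq r₂
  have e₁ := pushη_ofMem H x m₁ h₁
  have e₂ := pushη_ofMem H x m₂ h₂
  have e₃ := pushη_ofMem H x (H.isSaturated.trans m₁ m₂) ((isSaturated_pushE H).trans h₁ h₂)
  refine e₃.trans (Eq.trans ?_ (congrArg₂ (· ≫ ·) e₁ e₂).symm)
  exact (congrArg (Functor.whiskerRight · (L.forget v)) (plusη_trans H x m₁ m₂)).trans
    (Functor.whiskerRight_comp _ _ _)

/-- `𝒟'_[nil] = 𝟭` and right-whiskering by `𝟭` is invisible. [cite: MochizukiAbsTopIII2015, Definition 3.5 (i) pp.74–75] -/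
theorem whiskerRight_functor_id_heq {A B : Type*} [Category A] [Category B] {F G : A ⥤ B} (α : F ⟶ G) :
    HEq (Functor.whiskerRight α (𝟭 B)) α := by
  apply heq_of_eq
  ext X
  rfl

/-- The whiskering law (§0 (d)(e) / Def 3.5 (ii)) for the pushed homotopies, in the structural form `mkOfStrict` asks for.
[cite: MochizukiAbsTopIII2015, Definition 3.5 (ii) p.75] -/
theorem pushη_whisker (H : (L.logDiagramPlus v).HomotopyFamily) ⦃a' b' c' d' : (logShapeTS (isArc := isArc) v).Vertex⦄
    ⦃p' q' : Path a' b'⦄ (h : PushE (L := L) (v := v) H p' q') (r₁ : Path c' a') (r₂ : Path b' d') :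
    pushη H ((isSaturated_pushE H).precomp ((isSaturated_pushE H).postcomp h r₂) r₁) =
      eqToHom (by rw [DiagramOfCategories.pathFunctor'_comp, DiagramOfCategories.pathFunctor'_comp]) ≫
        Functor.whiskerLeft ((L.logDiagramTS v).pathFunctor' r₁)
          (Functor.whiskerRight (pushη H h) ((L.logDiagramTS v).pathFunctor' r₂)) ≫
        eqToHom (by rw [DiagramOfCategories.pathFunctor'_comp, DiagramOfCategories.pathFunctor'_comp]) := by
  obtain ⟨x, p, q, m, s, t, l, r⟩ := Classical.choice h
  subst s t
  cases eq_of_heq l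
  cases eq_of_heq r
  -- no path leaves `𝒩_v`
  have hd := eq_obs_of_path_from_obs v r₂
  subst hd
  cases eq_of_heq (path_from_obs_heq_nil v r₂)
  -- the prefix comes from the `⊞`-shape
  obtain ⟨y, hc, r₀, hr⟩ := exists_eq_mapPath v r₁ x rfl
  subst hc
  cases eq_of_heq hr
  -- canonical presentation of the whiskered pair
  have hP : ∀ s : Path ((logShapePlus (isArc := isArc) v).base x) (logShapePlus (isArc := isArc) v).obs,
      HEq (((plusToTS v).mapPath r₀).comp ((((plusToTS v).mapPath s).cons (forgetEdgeTS (isArc := isArc) v)).comp Path.nil))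
        (((plusToTS v).mapPath (r₀.comp s)).cons (forgetEdgeTS (isArc := isArc) v)) := fun s => by
    rw [Prefunctor.mapPath_comp]; rfl
  let w₀ : PushPair L v H (((plusToTS v).mapPath r₀).comp ((((plusToTS v).mapPath p).cons (forgetEdgeTS v)).comp Path.nil))
      (((plusToTS v).mapPath r₀).comp ((((plusToTS v).mapPath q).cons (forgetEdgeTS v)).comp Path.nil)) :=
    ⟨y, r₀.comp p, r₀.comp q, H.isSaturated.precomp m r₀, rfl, rfl, hP p, hP q⟩
  -- reduce to an `HEq` statement
  apply (conj_eqToHom_iff_heq' _ _ _ _).mpr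
  refine (heq_of_eq (pushη_eq H w₀)).trans ?_
  -- LHS: the pushed homotopy of the whiskered `⊞`-pair ≍ (𝒟_[r₀] ◁ ζ) ▷ forget
  have hE : ∀ s : Path ((logShapePlus (isArc := isArc) v).base x) (logShapePlus (isArc := isArc) v).obs,
      (L.logDiagramTS v).pathFunctor' ((plusToTS v).mapPath (r₀.comp s)) =
        (L.logDiagramPlus v).pathFunctor r₀ ⋙ (L.logDiagramPlus v).pathFunctor s := fun s =>
    (L.pathFunctor'_plusToTS_eq v y (r₀.comp s)).trans ((L.logDiagramPlus v).pathFunctor_comp r₀ s)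
  have h1 : HEq (pushηOfPair H w₀) (Functor.whiskerRight (plusη H y (H.isSaturated.precomp m r₀)) (L.forget v)) := by
    show HEq (eqToHom _ ≫ Functor.whiskerRight (plusη H y (H.isSaturated.precomp m r₀)) (L.forget v) ≫ eqToHom _) _
    exact heq_of_eqToHom_conj _ _ _
  have h2 : HEq (plusη H y (H.isSaturated.precomp m r₀))
      (Functor.whiskerLeft ((L.logDiagramPlus v).pathFunctor r₀) (H.η m)) := by
    refine (plusη_heq H y _).trans ?_
    refine (heq_of_eq (H.η_whisker m r₀ Path.nil)).trans ((heq_of_eqToHom_conj _ _ _).trans ?_)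
    refine whiskerLeft_heq_of_eq rfl (by rw [DiagramOfCategories.pathFunctor_nil]; rfl)
      (by rw [DiagramOfCategories.pathFunctor_nil]; rfl) ?_
    have h3 : HEq (Functor.whiskerRight (H.η m) ((L.logDiagramPlus v).pathFunctor Path.nil))
        (Functor.whiskerRight (H.η m) (𝟭 _)) := by
      rw [DiagramOfCategories.pathFunctor_nil]
    exact h3.trans (whiskerRight_functor_id_heq _)
  have hL : HEq (pushηOfPair H w₀)
      (Functor.whiskerRight (Functor.whiskerLeft ((L.logDiagramPlus v).pathFunctor r₀) (H.η m)) (L.forget v)) :=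
    h1.trans (whiskerRight_heq_of_heq (hE p) (hE q) h2 (L.forget v))
  refine hL.trans ?_
  -- RHS: 𝒟'_[Φ r₀] ◁ ((pushη h) ▷ 𝟭) with pushη h = plusη ▷ forget ≍ ζ ▷ forget
  have hRL : Functor.whiskerRight (Functor.whiskerLeft ((L.logDiagramPlus v).pathFunctor r₀) (H.η m)) (L.forget v) =
      Functor.whiskerLeft ((L.logDiagramPlus v).pathFunctor r₀) (Functor.whiskerRight (H.η m) (L.forget v)) := rfl
  refine (heq_of_eq hRL).trans ?_
  have hR : (L.logDiagramPlus v).pathFunctor r₀ = (L.logDiagramTS v).pathFunctor' ((plusToTS v).mapPath r₀) :=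
    (((L.logDiagramPlus v).pathFunctor_eq_pathFunctor' r₀).trans (eq_of_heq (L.pathFunctor'_plusToTS_heq v y r₀)).symm)
  refine whiskerLeft_heq_of_eq hR (congrArg (· ⋙ L.forget v) (L.pathFunctor'_plusToTS_eq v x p)).symm
    (congrArg (· ⋙ L.forget v) (L.pathFunctor'_plusToTS_eq v x q)).symm ?_
  have h4 : HEq (Functor.whiskerRight (H.η m) (L.forget v)) (pushη H h) :=
    (whiskerRight_heq_of_heq (L.pathFunctor'_plusToTS_eq v x p).symm (L.pathFunctor'_plusToTS_eq v x q).symm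
      (plusη_heq H x m).symm (L.forget v)).trans (heq_of_eq (pushη_ofMem H x m h).symm)
  exact h4.trans (whiskerRight_functor_id_heq _).symm

/-- **The pushed-forward family** `H ▷ (𝒩⊞_v → 𝒩_v)` on the `TS`-diagram (Def 3.5 (ii); built over the structural path
functors by abc-iut-L4-t12's `mkOfStrict`). [cite: MochizukiAbsTopIII2015, Definition 3.5 (ii) p.75] -/
noncomputable def pushFamily (H : (L.logDiagramPlus v).HomotopyFamily) : (L.logDiagramTS v).HomotopyFamily :=
  DiagramOfCategories.HomotopyFamily.mkOfStrict (PushE (L := L) (v := v) H) (isSaturated_pushE H) (pushη H)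
    (pushη_refl H) (pushη_trans H) (pushη_whisker H)

/-- The boundary set of the pushed family is `PushE`. [cite: MochizukiAbsTopIII2015, Definition 3.5 (ii) p.75] -/
theorem pushFamily_E (H : (L.logDiagramPlus v).HomotopyFamily) ⦃a' b' : (logShapeTS (isArc := isArc) v).Vertex⦄
    (p' q' : Path a' b') : (pushFamily H).E p' q' ↔ PushE (L := L) (v := v) H p' q' := Iff.rfl

/-- The homotopy of the pushed family at a canonical pair, componentwise: `(𝒩⊞_v → 𝒩_v)` applied to the component of `ζ`
(up to the canonical identifications of path functors). [cite: MochizukiAbsTopIII2015, Definition 3.5 (ii) p.75] -/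
theorem pushFamily_η_app_heq (H : (L.logDiagramPlus v).HomotopyFamily) (x : DSub (DVertex.InFirstRows (isArc := isArc) 2))
    {p q : Path ((logShapePlus (isArc := isArc) v).base x) (logShapePlus (isArc := isArc) v).obs} (h : H.E p q)
    (h' : (pushFamily H).E (((plusToTS v).mapPath p).cons (forgetEdgeTS v)) (((plusToTS v).mapPath q).cons (forgetEdgeTS v)))
    (X₀ : (L.logDiagramPlus v).obj ((logShapePlus (isArc := isArc) v).base x)) :
    HEq (((pushFamily H).η h').app X₀) ((L.forget v).map ((H.η h).app X₀)) := by
  have s1 : (pushFamily H).η h' = eqToHom ((L.logDiagramTS v).pathFunctor_eq_pathFunctor' _) ≫ pushη H h' ≫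
      eqToHom ((L.logDiagramTS v).pathFunctor_eq_pathFunctor' _).symm := rfl
  refine (heq_of_eq (congrArg (fun t => t.app X₀) s1)).trans ((app_eqToHom_conj_heq _ _ _ X₀).trans ?_)
  refine (heq_of_eq (congrArg (fun t => t.app X₀) (pushη_ofMem H x h h'))).trans ?_
  show HEq ((L.forget v).map ((plusη H x h).app X₀)) _
  exact map_heq_of_heq (L.forget v) (Functor.congr_obj (L.pathFunctor'_plusToTS_eq v x p) X₀)
    (Functor.congr_obj (L.pathFunctor'_plusToTS_eq v x q) X₀) (app_eqToHom_conj_heq _ _ _ X₀)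

/-! ## §5. At an ARCHIMEDEAN place: `S_log⊞_v` pushed forward IS an `S_log_v` -/

/-- The `TS` path functor of a pushed path is the `⊞` path functor followed by `𝒩⊞_v → 𝒩_v`.
[cite: MochizukiAbsTopIII2015, Definition 3.5 (i) pp.74–75] -/
theorem pathFunctor_push_eq (x : DSub (DVertex.InFirstRows (isArc := isArc) 2))
    (p : Path ((logShapePlus (isArc := isArc) v).base x) (logShapePlus (isArc := isArc) v).obs) :
    (L.logDiagramTS v).pathFunctor (((plusToTS v).mapPath p).cons (forgetEdgeTS v)) =
      (L.logDiagramPlus v).pathFunctor p ⋙ L.forget v :=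
  ((L.logDiagramTS v).pathFunctor_eq_pathFunctor' _).trans (congrArg (· ⋙ L.forget v) (L.pathFunctor'_plusToTS_eq v x p))

/-- The component identity of `IsLogObservableTS` at a pushed pair, from the `⊞` component identity and `ι = ι⊞ ▷ forget`.
[cite: MochizukiAbsTopIII2015, Cor 5.5 (iii) p. 131] -/
theorem pushFamily_η_app_eq (H : (L.logDiagramPlus v).HomotopyFamily) (x : DSub (DVertex.InFirstRows (isArc := isArc) 2))
    {p q : Path ((logShapePlus (isArc := isArc) v).base x) (logShapePlus (isArc := isArc) v).obs} (h : H.E p q)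
    (h' : (pushFamily H).E (((plusToTS v).mapPath p).cons (forgetEdgeTS v)) (((plusToTS v).mapPath q).cons (forgetEdgeTS v)))
    (X₀ : (L.logDiagramPlus v).obj ((logShapePlus (isArc := isArc) v).base x))
    {F G : (L.logDiagramPlus v).obj ((logShapePlus (isArc := isArc) v).base x) ⥤ L.Nplus v} (ι : F ⟶ G)
    (hobj : ((L.logDiagramPlus v).pathFunctor p).obj X₀ = F.obj X₀)
    (hobj' : G.obj X₀ = ((L.logDiagramPlus v).pathFunctor q).obj X₀)
    (hc : (H.η h).app X₀ = eqToHom hobj ≫ ι.app X₀ ≫ eqToHom hobj')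
    (hobjT : ((L.logDiagramTS v).pathFunctor (((plusToTS v).mapPath p).cons (forgetEdgeTS v))).obj X₀ = (F ⋙ L.forget v).obj X₀)
    (hobjT' : (G ⋙ L.forget v).obj X₀ = ((L.logDiagramTS v).pathFunctor (((plusToTS v).mapPath q).cons (forgetEdgeTS v))).obj X₀) :
    ((pushFamily H).η h').app X₀ = eqToHom hobjT ≫ (L.forget v).map (ι.app X₀) ≫ eqToHom hobjT' := by
  apply eq_of_heq
  refine (pushFamily_η_app_heq H x h h' X₀).trans ?_
  refine (heq_of_eq (congrArg (L.forget v).map hc)).trans ?_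
  have hm : (L.forget v).map (eqToHom hobj ≫ ι.app X₀ ≫ eqToHom hobj') =
      eqToHom (congrArg (L.forget v).obj hobj) ≫ (L.forget v).map (ι.app X₀) ≫ eqToHom (congrArg (L.forget v).obj hobj') := by
    rw [Functor.map_comp, Functor.map_comp, eqToHom_map, eqToHom_map]
  refine (heq_of_eq hm).trans ?_
  exact (heq_of_eqToHom_conj _ _ _).trans (heq_of_eqToHom_conj _ _ _).symm

variable (L v)

/-- **At an archimedean place the pushed family is an observable `S_log_v`** for every `TS`-datum: there `Γ⃗^log_v = Γ⃗^⋉_v` and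
`ι_{v,ε} = ι⊞_{v,ε} ▷ (𝒩⊞_v → 𝒩_v)` (abc-iut-L4-t5's `exists_iota_eq_whiskerRight`), which is exactly what the pushed homotopies
are at the printed pairs (`lamPathTS`, `postLogDomPathTS`, `postLogCodPathTS` are the pushed `⊞` paths, by `rfl`).
[cite: MochizukiAbsTopIII2015, Cor 5.5 (iii) p. 131] -/
theorem isLogObservableTS_pushFamily (T : L.TSHomotopies) (hv : isArc v = true) (H : (L.logDiagramPlus v).HomotopyFamily)
    (hH : L.IsLogObservablePlus v H) : L.IsLogObservableTS T v (pushFamily H) := by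
  refine ⟨fun a' b' p' q' ⟨w⟩ => w.tgt, ?_, ?_⟩
  · intro ν₁ ν₂ ε h₁ h₂
    obtain ⟨ε', rfl, hι⟩ := LogFrobeniusSetting.TSHomotopies.exists_iota_eq_whiskerRight L T v hv ε
    obtain ⟨hmem, hcomp⟩ := hH.2.1 ν₁ ν₂ ε' h₁ h₂
    have h' : (pushFamily H).E (lamPathTS (isArc := isArc) v ν₁ h₁) (lamPathTS v ν₂ h₂) :=
      ⟨PushPair.ofMem ⟨.core, core_mem_two⟩ hmem⟩
    refine ⟨h', fun X₀ => ?_⟩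
    obtain ⟨hobj, hobj', hc⟩ := hcomp X₀
    have hobjT := (Functor.congr_obj (pathFunctor_push_eq (L := L) (v := v) ⟨.core, core_mem_two⟩ (lamPath v ν₁ h₁)) X₀).trans
      (congrArg (L.forget v).obj hobj)
    have hobjT' := (congrArg (L.forget v).obj hobj').trans
      (Functor.congr_obj (pathFunctor_push_eq (L := L) (v := v) ⟨.core, core_mem_two⟩ (lamPath v ν₂ h₂)) X₀).symm
    refine ⟨hobjT, hobjT', ?_⟩
    rw [hι]
    exact pushFamily_η_app_eq H ⟨.core, core_mem_two⟩ hmem h' X₀ (L.iota v ε') hobj hobj' hc hobjT hobjT'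
  · intro ν₁ ν₂ ε h₁ h₂ hsl n
    obtain ⟨ε', rfl, hι⟩ := LogFrobeniusSetting.TSHomotopies.exists_iota_eq_whiskerRight L T v hv ε
    obtain ⟨hmem, hcomp⟩ := hH.2.2 ν₁ ν₂ ε' h₁ h₂ hsl n
    have h' : (pushFamily H).E (postLogDomPathTS (isArc := isArc) v n hsl) (postLogCodPathTS v n ν₂ h₂) :=
      ⟨PushPair.ofMem ⟨.row1 (n + 1), row1_mem_two (n + 1)⟩ hmem⟩
    refine ⟨h', fun X₀ => ?_⟩
    obtain ⟨hobj, hobj', hc⟩ := hcomp X₀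
    have hobjT := (Functor.congr_obj (pathFunctor_push_eq (L := L) (v := v) ⟨.row1 (n + 1), row1_mem_two (n + 1)⟩
      (postLogDomPath v n hsl)) X₀).trans (congrArg (L.forget v).obj hobj)
    have hobjT' := (congrArg (L.forget v).obj hobj').trans
      (Functor.congr_obj (pathFunctor_push_eq (L := L) (v := v) ⟨.row1 (n + 1), row1_mem_two (n + 1)⟩
        (postLogCodPath v n ν₂ h₂)) X₀).symm
    refine ⟨hobjT, hobjT', ?_⟩
    rw [hι]
    exact pushFamily_η_app_eq H ⟨.row1 (n + 1), row1_mem_two (n + 1)⟩ hmem h' X₀ (L.iota v ε') hobj hobj' hc hobjT hobjT'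

/-- **F-3080 at an archimedean place, for EVERY setting and EVERY `TS`-datum**: an observable `S_log_v` exists (the `⊞` side is
automatic there — abc-iut-f-101's `iotaSquaresCommute_of_isArc` — and pushes forward).
[cite: MochizukiAbsTopIII2015, Cor 5.5 (iii) p. 131] -/
theorem exists_isLogObservableTS_of_isArc (T : L.TSHomotopies) (hv : isArc v = true) :
    ∃ H : (L.logDiagramTS v).HomotopyFamily, L.IsLogObservableTS T v H := by
  obtain ⟨H, hH⟩ := (L.exists_isLogObservablePlus_iff v).mpr (L.iotaSquaresCommute_of_isArc v hv)
  exact ⟨pushFamily H, L.isLogObservableTS_pushFamily v T hv H hH⟩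

/-- **`Cor55ObservablesTS T` (F-3080) HOLDS for every setting over an all-archimedean index set and every `T`.**
[cite: MochizukiAbsTopIII2015, Cor 5.5 (iii) p. 131] -/
theorem cor55ObservablesTS_of_forall_isArc (hV : ∀ w : Vmod, isArc w = true) (T : L.TSHomotopies) :
    L.Cor55ObservablesTS T :=
  fun w => L.exists_isLogObservableTS_of_isArc w T (hV w)

/-- **The `S_log` constituent of Cor 5.5 (iv)'s `¬∃` is NON-VACUOUS at the archimedean carrier**: at abc-iut-w4-d095's
`archGenuine 𝔄` over an all-archimedean index set, `Cor55ObservablesTS T` holds for every `TS`-datum `T`.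
[cite: MochizukiAbsTopIII2015, Cor 5.5 (iii) p. 131] -/
theorem archGenuine_cor55ObservablesTS (𝔄 : AutHolFieldFunctor.{u}) (Vmod' : Type (u + 1)) (isArc' : Vmod' → Bool)
    (hV : ∀ w, isArc' w = true) (T : (archGenuine 𝔄 Vmod' isArc').TSHomotopies) :
    (archGenuine 𝔄 Vmod' isArc').Cor55ObservablesTS T :=
  (archGenuine 𝔄 Vmod' isArc').cor55ObservablesTS_of_forall_isArc hV T

end LogFrobeniusSetting

end Literature.AnabelianGeometry.AbsoluteAnabelian
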